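import Mathlib
import Literature.Analysis.FluidPDE.AxisymmetricEuler

/-!
# Needle portrait, axisymmetric case: the BAND LEMMA and the BATHTUB BRICK (ROUND-37 plate t38a)

Two self-contained real-variable bricks of ROUND-37 («the feeding-time race», seat nsreg-p2,
`HOME/ns-regularity-ideate-p2/ROUND-37.md` §1 (K), §2 (2), §2 (4); signature sheet `r37/Sketch37.lean`
entries `BandLaw` and `BathtubLaw` v1.1).  Helper material for crux E
(`EulerZoomLiouville.PowerGaugeEulerLiouville`, stmt-NavierStokesRegularity-19832); nothing here is
Euler-specific and nothing is wired into the LEAD's skeleton.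

* `sin_le_of_band` — **K-1D.**  `f ∈ C¹`, a level `m > 0`, a cap bound `ε > 0` such that every
  subinterval of `[0, π]` on which `f ≥ m/2` has length `≤ 2ε`, and `∫_0^π f′(θ)² sin θ dθ ≤ D₁`.  Then every
  `θ₀ ∈ [0, π]` with `f θ₀ ≥ m` has `sin θ₀ ≤ 2ε(1 + D₁/m²)`.  (Along a meridian of a sphere `S_t`, `f = −V_r`
  of an axisymmetric profile: a `γ`-fast latitude lies within `2ε t (1 + D₁/(γ²t²))` of the axis — Lemma K.)
* `sq_volume_le_integral_cylRadius_sq` — **bathtub.**  A measurable `A ⊆ closedBall 0 R` in `ℝ³` has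
  `|A|²/(32 R) ≤ ∫_A r⊥²`, `r⊥ = cylRadius` the distance to the `x₂`-axis: at most the box
  `[−r₁, r₁]² × [−R, R]` (volume `8 R r₁²`) of `A` lies within `r⊥ < r₁`; take `8 R r₁² = |A|/2`.
  (Stated on a ball so that the Bochner integral has no junk value.)
-/

open MeasureTheory Set Real intervalIntegral
open Literature.Analysis.FluidPDE

set_option linter.dupNamespace false

namespace Summit.NavierStokesRegularity.NavierStokesRegularity.Theorems.PowerGaugeEulerLiouville.NeedleAxisymBand

/-! ### 1. One-variable tools -/

/-- On `[0, π]` the sine is above the smaller of its endpoint values: `min (sin a) (sin b) ≤ sin θ`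
for `0 ≤ a ≤ θ ≤ b ≤ π` (concavity of `sin` on `[0, π]`, via monotonicity on the two halves). -/
theorem min_sin_le_sin {a b θ : ℝ} (ha : 0 ≤ a) (hb : b ≤ π) (haθ : a ≤ θ) (hθb : θ ≤ b) :
    min (Real.sin a) (Real.sin b) ≤ Real.sin θ := by
  by_cases h : θ ≤ π / 2
  · have h1 : Real.sin a ≤ Real.sin θ :=
      Real.sin_le_sin_of_le_of_le_pi_div_two (by linarith [Real.pi_pos]) h haθ
    exact (min_le_left _ _).trans h1
  · push Not at h
    have h1 : Real.sin (π - b) ≤ Real.sin (π - θ) :=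
      Real.sin_le_sin_of_le_of_le_pi_div_two (by linarith) (by linarith) (by linarith)
    rw [Real.sin_pi_sub, Real.sin_pi_sub] at h1
    exact (min_le_right _ _).trans h1

/-- Cauchy–Schwarz along an interval for a `C¹` function: `(f θ₁ − f θ₀)² ≤ (θ₁ − θ₀) · ∫_{θ₀}^{θ₁} f′²`
(expand `0 ≤ ∫ (f′ − c)²` with `c` the mean slope). -/
theorem sq_sub_le_mul_integral_sq {f f' : ℝ → ℝ} (hf : ∀ θ, HasDerivAt f (f' θ) θ)
    (hf'c : Continuous f') {θ₀ θ₁ : ℝ} (h : θ₀ < θ₁) :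
    (f θ₁ - f θ₀) ^ 2 ≤ (θ₁ - θ₀) * ∫ θ in θ₀..θ₁, f' θ ^ 2 := by
  have hL : 0 < θ₁ - θ₀ := sub_pos.2 h
  have hftc : ∫ θ in θ₀..θ₁, f' θ = f θ₁ - f θ₀ :=
    integral_eq_sub_of_hasDerivAt (fun θ _ => hf θ) (hf'c.intervalIntegrable _ _)
  set Δ := f θ₁ - f θ₀ with hΔ
  set I := ∫ θ in θ₀..θ₁, f' θ ^ 2 with hI
  set c := Δ / (θ₁ - θ₀) with hc
  have i1 : IntervalIntegrable (fun θ => f' θ ^ 2) volume θ₀ θ₁ := (hf'c.pow 2).intervalIntegrable _ _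
  have i2 : IntervalIntegrable (fun θ => (2 * c) * f' θ) volume θ₀ θ₁ :=
    (continuous_const.mul hf'c).intervalIntegrable _ _
  have i3 : IntervalIntegrable (fun _ => c ^ 2) volume θ₀ θ₁ := intervalIntegrable_const
  have h0 : 0 ≤ ∫ θ in θ₀..θ₁, (f' θ - c) ^ 2 :=
    intervalIntegral.integral_nonneg h.le fun θ _ => sq_nonneg _
  have hexp : ∫ θ in θ₀..θ₁, (f' θ - c) ^ 2 = I - (2 * c) * Δ + (θ₁ - θ₀) * c ^ 2 := by
    have hpt : (fun θ => (f' θ - c) ^ 2) = fun θ => (f' θ ^ 2 - (2 * c) * f' θ) + c ^ 2 := by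
      funext θ; ring
    rw [hpt, intervalIntegral.integral_add (i1.sub i2) i3, intervalIntegral.integral_sub i1 i2,
      intervalIntegral.integral_const_mul, hftc, intervalIntegral.integral_const, smul_eq_mul]
  have hcL : c * (θ₁ - θ₀) = Δ := by rw [hc]; field_simp
  have hkey : 0 ≤ I - Δ ^ 2 / (θ₁ - θ₀) := by
    have : I - (2 * c) * Δ + (θ₁ - θ₀) * c ^ 2 = I - Δ ^ 2 / (θ₁ - θ₀) := by
      rw [hc]; field_simp; ring
    linarith [h0, hexp, this]
  have := (div_le_iff₀ hL).1 (sub_nonneg.1 hkey)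
  linarith [this]

/-! ### 2. The band lemma (K-1D) -/

/-- **Band lemma (K-1D; ROUND-37 Lemma K along a meridian).**  Let `f` be `C¹`, `m > 0`, `ε > 0`;
assume every subinterval `[a, b] ⊆ [0, π]` on which `f ≥ m/2` has length `b − a ≤ 2ε` (the cap-thinness
input), and `∫_0^π f′(θ)² sin θ dθ ≤ D₁` (the meridional Dirichlet budget).  Then every `θ₀ ∈ [0, π]` with
`f θ₀ ≥ m` satisfies `sin θ₀ ≤ 2ε (1 + D₁/m²)`.  Proof: the component `(a, b) ∋ θ₀` of `{f > m/2}` has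
`b − a ≤ 2ε`; if it touches a pole, `sin θ₀ ≤ 2ε`; otherwise `f a = f b… ≤ m/2`, Cauchy–Schwarz on
`[a, θ₀]` and `[θ₀, b]` gives `∫_a^b f′² sin ≥ min(sin a, sin b) · m²/(b − a)`, so
`min(sin a, sin b) ≤ 2εD₁/m²`, and `sin` is 1-Lipschitz. -/
theorem sin_le_of_band {f f' : ℝ → ℝ} (hf : ∀ θ, HasDerivAt f (f' θ) θ) (hf'c : Continuous f')
    {m ε D₁ : ℝ} (hm : 0 < m) (hε : 0 < ε)
    (hcap : ∀ a b : ℝ, 0 ≤ a → a ≤ b → b ≤ π → (∀ θ ∈ Icc a b, m / 2 ≤ f θ) → b - a ≤ 2 * ε)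
    (hD : ∫ θ in (0 : ℝ)..π, f' θ ^ 2 * Real.sin θ ≤ D₁)
    {θ₀ : ℝ} (hθ₀ : θ₀ ∈ Icc (0 : ℝ) π) (hfθ₀ : m ≤ f θ₀) :
    Real.sin θ₀ ≤ 2 * ε * (1 + D₁ / m ^ 2) := by
  have hfc : Continuous f := continuous_iff_continuousAt.2 fun θ => (hf θ).continuousAt
  obtain ⟨h0θ, hθπ⟩ := hθ₀
  -- the weighted Dirichlet integrand is nonnegative on `[0, π]`, so `0 ≤ D₁`
  have hnn : ∀ θ ∈ Icc (0 : ℝ) π, 0 ≤ f' θ ^ 2 * Real.sin θ := fun θ hθ =>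
    mul_nonneg (sq_nonneg _) (Real.sin_nonneg_of_mem_Icc hθ)
  have hD0 : 0 ≤ D₁ := (intervalIntegral.integral_nonneg Real.pi_pos.le hnn).trans hD
  have hbase : 2 * ε ≤ 2 * ε * (1 + D₁ / m ^ 2) := by
    have : 0 ≤ D₁ / m ^ 2 := div_nonneg hD0 (sq_nonneg _)
    nlinarith
  have hm2 : m / 2 < m := by linarith
  -- left and right "dip" sets
  set Ls : Set ℝ := Icc 0 θ₀ ∩ {θ | f θ ≤ m / 2} with hLs
  set Rs : Set ℝ := Icc θ₀ π ∩ {θ | f θ ≤ m / 2} with hRs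
  have hLc : IsClosed Ls := isClosed_Icc.inter (isClosed_le hfc continuous_const)
  have hRc : IsClosed Rs := isClosed_Icc.inter (isClosed_le hfc continuous_const)
  -- polar cases
  by_cases hLne : Ls.Nonempty
  swap
  · -- `f > m/2` on `[0, θ₀]`: the band touches the pole `θ = 0`
    have hall : ∀ θ ∈ Icc 0 θ₀, m / 2 ≤ f θ := by
      intro θ hθ; by_contra hlt; push Not at hlt
      exact hLne ⟨θ, hθ, hlt.le⟩
    have hw := hcap 0 θ₀ le_rfl h0θ hθπ hall
    have : Real.sin θ₀ ≤ θ₀ := Real.sin_le h0θ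
    linarith
  by_cases hRne : Rs.Nonempty
  swap
  · have hall : ∀ θ ∈ Icc θ₀ π, m / 2 ≤ f θ := by
      intro θ hθ; by_contra hlt; push Not at hlt
      exact hRne ⟨θ, hθ, hlt.le⟩
    have hw := hcap θ₀ π h0θ hθπ le_rfl hall
    have : Real.sin θ₀ ≤ π - θ₀ := by
      rw [← Real.sin_pi_sub]; exact Real.sin_le (by linarith)
    linarith
  -- main case: `a = sup Ls < θ₀ < b = inf Rs`
  have hLb : BddAbove Ls := ⟨θ₀, fun θ hθ => hθ.1.2⟩
  have hRb : BddBelow Rs := ⟨θ₀, fun θ hθ => hθ.1.1⟩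
  set a := sSup Ls with ha
  set b := sInf Rs with hb
  have haL : a ∈ Ls := hLc.csSup_mem hLne hLb
  have hbR : b ∈ Rs := hRc.csInf_mem hRne hRb
  have ha0 : 0 ≤ a := haL.1.1
  have haθ : a ≤ θ₀ := haL.1.2
  have hfa : f a ≤ m / 2 := haL.2
  have hbπ : b ≤ π := hbR.1.2
  have hθb : θ₀ ≤ b := hbR.1.1
  have hfb : f b ≤ m / 2 := hbR.2
  have haθ' : a < θ₀ := lt_of_le_of_ne haθ fun h => by rw [h] at hfa; linarith
  have hθb' : θ₀ < b := lt_of_le_of_ne hθb fun h => by rw [← h] at hfb; linarith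
  -- `f > m/2` strictly inside `(a, b)`
  have hmid : ∀ θ, a < θ → θ < b → m / 2 < f θ := by
    intro θ h1 h2
    by_contra hle; push Not at hle
    rcases le_total θ θ₀ with hθ | hθ
    · have : θ ∈ Ls := ⟨⟨ha0.trans h1.le, hθ⟩, hle⟩
      exact absurd (le_csSup hLb this) (not_le.2 h1)
    · have : θ ∈ Rs := ⟨⟨hθ, h2.le.trans hbπ⟩, hle⟩
      exact absurd (csInf_le hRb this) (not_le.2 h2)
  -- width of the band
  have hwidth : b - a ≤ 2 * ε := by
    refine le_of_forall_pos_le_add fun η hη => ?_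
    set δ := min (η / 2) (min ((θ₀ - a) / 2) ((b - θ₀) / 2)) with hδ
    have hδpos : 0 < δ := by positivity
    have hδ1 : δ ≤ η / 2 := min_le_left _ _
    have hδ2 : δ ≤ (θ₀ - a) / 2 := (min_le_right _ _).trans (min_le_left _ _)
    have hδ3 : δ ≤ (b - θ₀) / 2 := (min_le_right _ _).trans (min_le_right _ _)
    have hsub : ∀ θ ∈ Icc (a + δ) (b - δ), m / 2 ≤ f θ := fun θ hθ =>
      (hmid θ (by linarith [hθ.1]) (by linarith [hθ.2])).le
    have := hcap (a + δ) (b - δ) (by linarith) (by linarith) (by linarith) hsub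
    linarith
  -- Cauchy–Schwarz on the two halves
  set x := θ₀ - a with hx
  set y := b - θ₀ with hy
  have hxpos : 0 < x := by rw [hx]; linarith
  have hypos : 0 < y := by rw [hy]; linarith
  have hI₁ : m ^ 2 / 4 ≤ x * ∫ θ in a..θ₀, f' θ ^ 2 := by
    have h1 := sq_sub_le_mul_integral_sq hf hf'c haθ'
    have h2 : m / 2 ≤ f θ₀ - f a := by linarith
    have h3 : (m / 2) ^ 2 ≤ (f θ₀ - f a) ^ 2 := pow_le_pow_left₀ (by linarith) h2 2
    rw [hx]; linarith [h1, h3]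
  have hI₂ : m ^ 2 / 4 ≤ y * ∫ θ in θ₀..b, f' θ ^ 2 := by
    have h1 := sq_sub_le_mul_integral_sq hf hf'c hθb'
    have h2 : m / 2 ≤ f θ₀ - f b := by linarith
    have h3 : (m / 2) ^ 2 ≤ (f b - f θ₀) ^ 2 := by
      rw [show (f b - f θ₀) ^ 2 = (f θ₀ - f b) ^ 2 by ring]
      exact pow_le_pow_left₀ (by linarith) h2 2
    rw [hy]; linarith [h1, h3]
  -- the weight: `sin ≥ σ := min (sin a) (sin b) ≥ 0` on `[a, b]`
  set σ := min (Real.sin a) (Real.sin b) with hσ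
  have hσ0 : 0 ≤ σ := le_min (Real.sin_nonneg_of_mem_Icc ⟨ha0, by linarith⟩)
    (Real.sin_nonneg_of_mem_Icc ⟨by linarith, hbπ⟩)
  have i_sq : ∀ u v : ℝ, IntervalIntegrable (fun θ => f' θ ^ 2) volume u v := fun u v =>
    (hf'c.pow 2).intervalIntegrable _ _
  have i_w : ∀ u v : ℝ, IntervalIntegrable (fun θ => f' θ ^ 2 * Real.sin θ) volume u v := fun u v =>
    ((hf'c.pow 2).mul Real.continuous_sin).intervalIntegrable _ _
  -- `σ ∫_a^b f'^2 ≤ ∫_a^b f'^2 sin ≤ ∫_0^π f'^2 sin ≤ D₁`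
  have hwt : σ * ∫ θ in a..b, f' θ ^ 2 ≤ ∫ θ in a..b, f' θ ^ 2 * Real.sin θ := by
    rw [← intervalIntegral.integral_const_mul]
    refine intervalIntegral.integral_mono_on (by linarith) ?_ (i_w a b) fun θ hθ => ?_
    · exact (continuous_const.mul (hf'c.pow 2)).intervalIntegrable _ _
    · have := min_sin_le_sin ha0 hbπ hθ.1 hθ.2
      rw [← hσ] at this
      nlinarith [sq_nonneg (f' θ)]
  have hsubint : ∫ θ in a..b, f' θ ^ 2 * Real.sin θ ≤ ∫ θ in (0 : ℝ)..π, f' θ ^ 2 * Real.sin θ := by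
    refine intervalIntegral.integral_mono_interval ha0 (by linarith) hbπ ?_ (i_w 0 π)
    refine (ae_restrict_mem measurableSet_Ioc).mono fun θ hθ => ?_
    exact mul_nonneg (sq_nonneg _) (Real.sin_nonneg_of_mem_Icc ⟨hθ.1.le, hθ.2⟩)
  have hsplit : ∫ θ in a..b, f' θ ^ 2 = (∫ θ in a..θ₀, f' θ ^ 2) + ∫ θ in θ₀..b, f' θ ^ 2 :=
    (intervalIntegral.integral_add_adjacent_intervals (i_sq a θ₀) (i_sq θ₀ b)).symm
  -- AM–HM: `m²/(2ε) ≤ ∫_a^b f'^2`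
  have hsum : m ^ 2 / (2 * ε) ≤ ∫ θ in a..b, f' θ ^ 2 := by
    set I₁ := ∫ θ in a..θ₀, f' θ ^ 2
    set I₂ := ∫ θ in θ₀..b, f' θ ^ 2
    have h1 : m ^ 2 / (4 * x) ≤ I₁ := by
      rw [div_le_iff₀ (by positivity)]; linarith [hI₁]
    have h2 : m ^ 2 / (4 * y) ≤ I₂ := by
      rw [div_le_iff₀ (by positivity)]; linarith [hI₂]
    have hxy : x + y ≤ 2 * ε := by rw [hx, hy]; linarith [hwidth]
    have hamhm : m ^ 2 / (2 * ε) ≤ m ^ 2 / (4 * x) + m ^ 2 / (4 * y) := by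
      rw [div_add_div _ _ (by positivity) (by positivity), div_le_div_iff₀ (by positivity) (by positivity)]
      have hm2 : 0 ≤ m ^ 2 := sq_nonneg m
      nlinarith [sq_nonneg (x - y), mul_nonneg hm2 (sq_nonneg (x - y)), hxy, hxpos, hypos,
        mul_nonneg hm2 (mul_nonneg hxpos.le hypos.le)]
    rw [hsplit]; linarith
  have hσD : σ * (m ^ 2 / (2 * ε)) ≤ D₁ := by
    calc σ * (m ^ 2 / (2 * ε)) ≤ σ * ∫ θ in a..b, f' θ ^ 2 := mul_le_mul_of_nonneg_left hsum hσ0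
      _ ≤ D₁ := (hwt.trans hsubint).trans hD
  have hσle : σ ≤ 2 * ε * (D₁ / m ^ 2) := by
    have hm2 : 0 < m ^ 2 := by positivity
    have h' : σ * m ^ 2 ≤ D₁ * (2 * ε) := by
      have h1 : σ * m ^ 2 = σ * (m ^ 2 / (2 * ε)) * (2 * ε) := by field_simp
      rw [h1]
      exact mul_le_mul_of_nonneg_right hσD (by positivity)
    rw [show 2 * ε * (D₁ / m ^ 2) = D₁ * (2 * ε) / m ^ 2 by ring, le_div_iff₀ hm2]
    exact h'
  -- `sin` is 1-Lipschitz
  have hLip1 : Real.sin θ₀ ≤ Real.sin a + (θ₀ - a) := by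
    have := Real.abs_sin_sub_sin_le θ₀ a
    rw [abs_of_nonneg (by linarith : 0 ≤ θ₀ - a)] at this
    linarith [le_abs_self (Real.sin θ₀ - Real.sin a)]
  have hLip2 : Real.sin θ₀ ≤ Real.sin b + (b - θ₀) := by
    have := Real.abs_sin_sub_sin_le θ₀ b
    rw [abs_of_nonpos (by linarith : θ₀ - b ≤ 0)] at this
    linarith [le_abs_self (Real.sin θ₀ - Real.sin b)]
  have hfin : Real.sin θ₀ ≤ σ + (b - a) := by
    rcases min_choice (Real.sin a) (Real.sin b) with h | h <;> rw [hσ, h] <;> linarith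
  calc Real.sin θ₀ ≤ σ + (b - a) := hfin
    _ ≤ 2 * ε * (D₁ / m ^ 2) + 2 * ε := add_le_add hσle hwidth
    _ = 2 * ε * (1 + D₁ / m ^ 2) := by ring


/-! ### 3. The bathtub brick -/

/-- A coordinate is bounded by the Euclidean norm: `|y i| ≤ ‖y‖` in `ℝ³`. -/
theorem abs_apply_le_norm (y : EuclideanSpace ℝ (Fin 3)) (i : Fin 3) : |y i| ≤ ‖y‖ := by
  rw [EuclideanSpace.norm_eq]
  refine Real.abs_le_sqrt ?_
  have : y i ^ 2 = ‖y i‖ ^ 2 := by simp [Real.norm_eq_abs, sq_abs]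
  rw [this]
  exact Finset.single_le_sum (f := fun j => ‖y j‖ ^ 2) (fun j _ => sq_nonneg _) (Finset.mem_univ i)

/-- The coordinate box `{|y 0| ≤ r, |y 1| ≤ r, |y 2| ≤ R}` has volume at most `8 R r²`
(it is the preimage of `[-r,r]² × [-R,R]` under the measure-preserving `WithLp.ofLp`, `PiLp.volume_preserving_ofLp`). -/
theorem volume_box_le {r R : ℝ} (hr : 0 ≤ r) :
    volume {y : EuclideanSpace ℝ (Fin 3) | |y 0| ≤ r ∧ |y 1| ≤ r ∧ |y 2| ≤ R} ≤
      ENNReal.ofReal (8 * R * r ^ 2) := by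
  set c : Fin 3 → ℝ := ![r, r, R] with hc
  have hset : {y : EuclideanSpace ℝ (Fin 3) | |y 0| ≤ r ∧ |y 1| ≤ r ∧ |y 2| ≤ R} ⊆
      (WithLp.ofLp : EuclideanSpace ℝ (Fin 3) → (Fin 3 → ℝ)) ⁻¹'
        Set.pi Set.univ fun i => Icc (-c i) (c i) := by
    rintro y ⟨h0, h1, h2⟩
    rw [abs_le] at h0 h1 h2
    simp only [mem_preimage, mem_pi, mem_univ, true_implies, mem_Icc]
    intro i
    fin_cases i
    · simpa [hc] using h0
    · simpa [hc] using h1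
    · simpa [hc] using h2
  refine (measure_mono hset).trans (le_of_eq ?_)
  rw [(PiLp.volume_preserving_ofLp (Fin 3)).measure_preimage
    (MeasurableSet.univ_pi fun _ => measurableSet_Icc).nullMeasurableSet, volume_pi,
    Measure.pi_pi]
  simp only [Real.volume_Icc, Fin.prod_univ_three, hc, Matrix.cons_val_zero, Matrix.cons_val_one,
    Matrix.cons_val_two, Matrix.tail_cons, Matrix.head_cons]
  rw [← ENNReal.ofReal_mul (by linarith), ← ENNReal.ofReal_mul (by nlinarith)]
  congr 1
  ring

/-- **Bathtub brick (ROUND-37 §2 (4)).**  For a measurable `A ⊆ closedBall 0 R` in `ℝ³`,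
`|A|² / (32 R) ≤ ∫_A r⊥²` with `r⊥ = cylRadius` the distance to the `x₂`-axis: the part of `A` with
`r⊥ < r₁` lies in the box `[-r₁, r₁]² × [-R, R]` of volume `8 R r₁²`; with `8 R r₁² = |A|/2` the rest of `A`
has volume `≥ |A|/2` and carries `r⊥² ≥ r₁² = |A|/(16 R)`. -/
theorem sq_volume_le_integral_cylRadius_sq {R : ℝ} (hR : 0 < R) {A : Set (EuclideanSpace ℝ (Fin 3))}
    (hA : MeasurableSet A) (hAB : A ⊆ Metric.closedBall (0 : EuclideanSpace ℝ (Fin 3)) R) :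
    (volume A).toReal ^ 2 / (32 * R) ≤ ∫ y in A, cylRadius y ^ 2 := by
  have hAfin : volume A < ⊤ := (measure_mono hAB).trans_lt measure_closedBall_lt_top
  set v := (volume A).toReal with hv
  have hv0 : 0 ≤ v := ENNReal.toReal_nonneg
  -- integrability of `r⊥²` on `A` (continuous on the compact ball)
  have hint : IntegrableOn (fun y : EuclideanSpace ℝ (Fin 3) => cylRadius y ^ 2) A volume :=
    ((continuous_cylRadius.pow 2).continuousOn.integrableOn_compact
      (isCompact_closedBall (0 : EuclideanSpace ℝ (Fin 3)) R)).mono_set hAB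
  have hnonneg : 0 ≤ ∫ y in A, cylRadius y ^ 2 := setIntegral_nonneg hA fun y _ => sq_nonneg _
  rcases hv0.eq_or_lt with hv00 | hvpos
  · rw [← hv00]; simpa using hnonneg
  -- the threshold radius `r₁` with `r₁² = v/(16R)`
  set r₁ := Real.sqrt (v / (16 * R)) with hr₁
  have hr₁0 : 0 ≤ r₁ := Real.sqrt_nonneg _
  have hr₁sq : r₁ ^ 2 = v / (16 * R) := Real.sq_sqrt (by positivity)
  set S : Set (EuclideanSpace ℝ (Fin 3)) := {y | cylRadius y < r₁} with hS
  have hSm : MeasurableSet S := measurableSet_lt continuous_cylRadius.measurable measurable_const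
  -- the near-axis part of `A` lies in the box
  have hsub : A ∩ S ⊆ {y : EuclideanSpace ℝ (Fin 3) | |y 0| ≤ r₁ ∧ |y 1| ≤ r₁ ∧ |y 2| ≤ R} := by
    rintro y ⟨hyA, hyS⟩
    have hyR : ‖y‖ ≤ R := by simpa using hAB hyA
    have hcr : cylRadius y ^ 2 < r₁ ^ 2 := by
      have := hyS; rw [hS, mem_setOf_eq] at this
      exact pow_lt_pow_left₀ this (cylRadius_nonneg y) two_ne_zero
    rw [cylRadius_sq] at hcr
    refine ⟨?_, ?_, (abs_apply_le_norm y 2).trans hyR⟩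
    · rw [← Real.sqrt_sq hr₁0]; exact Real.abs_le_sqrt (by nlinarith [sq_nonneg (y 1)])
    · rw [← Real.sqrt_sq hr₁0]; exact Real.abs_le_sqrt (by nlinarith [sq_nonneg (y 0)])
  have hnear : (volume (A ∩ S)).toReal ≤ v / 2 := by
    have h1 : volume (A ∩ S) ≤ ENNReal.ofReal (8 * R * r₁ ^ 2) :=
      (measure_mono hsub).trans (volume_box_le hr₁0)
    have h2 : 8 * R * r₁ ^ 2 = v / 2 := by rw [hr₁sq]; field_simp; ring
    rw [← h2]
    exact ENNReal.toReal_le_of_le_ofReal (by positivity) h1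
  -- volume bookkeeping: `|A \ S| ≥ v/2`
  have hsplit : volume (A ∩ S) + volume (A \ S) = volume A := measure_inter_add_sdiff A hSm
  have hfarfin : volume (A \ S) < ⊤ := (measure_mono sdiff_subset).trans_lt hAfin
  have hnearfin : volume (A ∩ S) < ⊤ := (measure_mono inter_subset_left).trans_lt hAfin
  have hfar : v / 2 ≤ (volume (A \ S)).toReal := by
    have : (volume (A ∩ S)).toReal + (volume (A \ S)).toReal = v := by
      rw [hv, ← hsplit, ENNReal.toReal_add hnearfin.ne hfarfin.ne]
    linarith
  -- on `A \ S` the integrand is `≥ r₁²`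
  have hAS : MeasurableSet (A \ S) := hA.diff hSm
  have hlow : r₁ ^ 2 * (volume (A \ S)).toReal ≤ ∫ y in A \ S, cylRadius y ^ 2 := by
    have hconst : ∫ _ in A \ S, r₁ ^ 2 ∂(volume : Measure (EuclideanSpace ℝ (Fin 3))) =
        (volume (A \ S)).toReal * r₁ ^ 2 := by
      rw [setIntegral_const, smul_eq_mul, measureReal_def]
    rw [mul_comm, ← hconst]
    refine setIntegral_mono_on (integrableOn_const hfarfin.ne) (hint.mono_set sdiff_subset) hAS
      fun y hy => ?_
    have : r₁ ≤ cylRadius y := by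
      have := hy.2; rw [hS, mem_setOf_eq, not_lt] at this; exact this
    exact pow_le_pow_left₀ hr₁0 this 2
  have hmono : ∫ y in A \ S, cylRadius y ^ 2 ≤ ∫ y in A, cylRadius y ^ 2 :=
    setIntegral_mono_set hint (Filter.Eventually.of_forall fun y => sq_nonneg _)
      (Filter.Eventually.of_forall sdiff_subset)
  calc v ^ 2 / (32 * R) = r₁ ^ 2 * (v / 2) := by rw [hr₁sq]; field_simp; ring
    _ ≤ r₁ ^ 2 * (volume (A \ S)).toReal := mul_le_mul_of_nonneg_left hfar (sq_nonneg _)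
    _ ≤ ∫ y in A \ S, cylRadius y ^ 2 := hlow
    _ ≤ ∫ y in A, cylRadius y ^ 2 := hmono

end Summit.NavierStokesRegularity.NavierStokesRegularity.Theorems.PowerGaugeEulerLiouville.NeedleAxisymBand
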